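import Mathlib
import Summits.Ventures.HodgeRepro2.T5SmoothIsotypic
import Summits.Ventures.HodgeRepro2.T6N5LocalDatum
import Summits.Ventures.HodgeRepro2.T6N5LocalWeil
import Summits.Ventures.HodgeRepro2.T6N5LocalInertCompletion
import Summits.Ventures.HodgeRepro2.T6N5LocalWeilQuotient

/-!
# T6N5LocalQuotientToy — Tier 6, M2 sub-step N5 (t6-p8's half): a carried Weil representation over
`U(V) = E_v^×/F_v^×` ON MATHLIB'S COMPLETIONS, smooth for the finite-index AND the open subgroups, whose
`α`-isotypic components are non-zero exactly for the smooth conjugate-orthogonal `α_K` of a prescribed sign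

The completion-level half of the README §10.5(ii)(c),(d) witnesses for the per-place statements of record v2
(`T6N5LocalWeilQuotientSmooth`): over `L_w^×` with its subgroup `F_v^× = Fsub v w`, a filtration `U` (the
principal units) and a sign function `sgn` on the characters (to be `ε_v(χ_W⁻¹ ·)`), the Weil representation of
the line `V_s` is modelled as the direct sum of the characters of the «good» set
`Good s = {ξ conjugate-orthogonal, smooth, sgn ξ = s}` (`Wsp s = Good s →₀ ℂ`, the diagonal action `ρ s` of
`E_v^×/F_v^×` through the lifted characters). Then
* `isotypic_ne_bot_iff`: the `α`-isotypic component is non-zero iff `α_K = ofOneQ α ∈ Good s`;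
* `isSmoothCompact`: every vector is fixed by a finite-index subgroup — the kernels of the finitely many smooth
  conjugate-orthogonal characters in its support (`[E_v^× : F_v^× U_E^n] < ∞`, the hypothesis `hUfin`, p4's
  `T5AdicCompletionUnitIndex` on the completions);
* `isSmoothOpen`: every vector is fixed by the image of some `U n` (open smoothness);
* `instNontrivialWsp`: both spaces are non-zero as soon as both signs occur on smooth conjugate-orthogonal
  characters (`hboth`).
README §8(d): uses an L-value-free non-vanishing device: NO.
-/

namespace Summit.Ventures.HodgeRepro2.T6.N5LocalQuotientToy

open Summit.Ventures.HodgeRepro2 IsDedekindDomain HeightOneSpectrum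
  Summit.Ventures.HodgeRepro2.T6.N5LocalDatum Summit.Ventures.HodgeRepro2.T6.N5LocalWeil
  Summit.Ventures.HodgeRepro2.T6.N5LocalInertCompletion Summit.Ventures.HodgeRepro2.T6.N5LocalWeilQuotient
  Summit.Ventures.HodgeRepro2.T5SmoothIsotypic

-- `K`, `L` in `Type` (universe `0`).
variable {K : Type} [Field K] [NumberField K] (v : HeightOneSpectrum (NumberField.RingOfIntegers K))
  {L : Type} [Field L] [NumberField L] [Algebra K L] (w : HeightOneSpectrum (NumberField.RingOfIntegers L))
  [w.asIdeal.LiesOver v.asIdeal]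
  (U : ℕ → Subgroup (w.adicCompletion L)ˣ) (sgn : ((w.adicCompletion L)ˣ →* ℂˣ) → ℤˣ)

noncomputable section

/-- The characters occurring in the Weil representation of the line `V_s`: conjugate-orthogonal (trivial on
`F_v^×`), smooth (trivial on some `U n`), of sign `s`. -/
def Good (s : ℤˣ) : Set ((w.adicCompletion L)ˣ →* ℂˣ) :=
  {ξ | (∀ f ∈ Fsub v w, ξ f = 1) ∧ (∃ n, U n ≤ ξ.ker) ∧ sgn ξ = s}

/-- A conjugate-orthogonal character kills `F_v^×`. -/
theorem Fsub_le_ker {ξ : (w.adicCompletion L)ˣ →* ℂˣ} (h : ∀ f ∈ Fsub v w, ξ f = 1) : Fsub v w ≤ ξ.ker :=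
  fun f hf => MonoidHom.mem_ker.mpr (h f hf)

/-- A character of `Good s`, lifted to the quotient `E_v^×/F_v^×`. -/
def liftG {s : ℤˣ} (ξ : Good v w U sgn s) : ((w.adicCompletion L)ˣ ⧸ Fsub v w) →* ℂˣ :=
  QuotientGroup.lift (Fsub v w) ξ.1 (Fsub_le_ker v w ξ.2.1)

/-- The lifted character on the class of `x`. -/
theorem liftG_mk {s : ℤˣ} (ξ : Good v w U sgn s) (x : (w.adicCompletion L)ˣ) :
    liftG v w U sgn ξ (x : (w.adicCompletion L)ˣ ⧸ Fsub v w) = ξ.1 x :=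
  QuotientGroup.lift_mk (Fsub v w) _ x

/-- Evaluation of a lifted character at an element of `Multiplicative (QuotA v w)`, as a complex number. -/
def evalAt {s : ℤˣ} (ξ : Good v w U sgn s) (g : Multiplicative (QuotA v w)) : ℂ :=
  ((liftG v w U sgn ξ (Additive.toMul (Multiplicative.toAdd g)) : ℂˣ) : ℂ)

/-- `evalAt` at the identity. -/
theorem evalAt_one {s : ℤˣ} (ξ : Good v w U sgn s) : evalAt v w U sgn ξ 1 = 1 := by
  simp [evalAt]

/-- `evalAt` is multiplicative. -/
theorem evalAt_mul {s : ℤˣ} (ξ : Good v w U sgn s) (g h : Multiplicative (QuotA v w)) :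
    evalAt v w U sgn ξ (g * h) = evalAt v w U sgn ξ g * evalAt v w U sgn ξ h := by
  simp [evalAt, toAdd_mul, toMul_add]

/-- `evalAt` at the image of `x`: the value of the character at `x`. -/
theorem evalAt_toMulAdd {s : ℤˣ} (ξ : Good v w U sgn s) (x : (w.adicCompletion L)ˣ) :
    evalAt v w U sgn ξ (toMulAdd v w x) = ((ξ.1 x : ℂˣ) : ℂ) := by
  show ((liftG v w U sgn ξ (Additive.toMul (Multiplicative.toAdd (Multiplicative.ofAdd
    (Additive.ofMul (x : (w.adicCompletion L)ˣ ⧸ Fsub v w))))) : ℂˣ) : ℂ) = _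
  rw [toAdd_ofAdd, toMul_ofMul, liftG_mk]

/-- The space of the Weil representation of `V_s`: finitely supported functions on `Good s`. -/
abbrev Wsp (s : ℤˣ) : Type := Good v w U sgn s →₀ ℂ

/-- The diagonal action of `g` on `Wsp s`: `(g · x)(ξ) = ξ(g) x(ξ)`. -/
def op (s : ℤˣ) (g : Multiplicative (QuotA v w)) : Wsp v w U sgn s →ₗ[ℂ] Wsp v w U sgn s where
  toFun x := (fun ξ : Good v w U sgn s => evalAt v w U sgn ξ g) • x
  map_add' x y := by
    ext ξ
    simp [mul_add]
  map_smul' c x := by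
    ext ξ
    simp [mul_left_comm]

/-- Coordinates of the diagonal action. -/
theorem op_apply (s : ℤˣ) (g : Multiplicative (QuotA v w)) (x : Wsp v w U sgn s) (ξ : Good v w U sgn s) :
    op v w U sgn s g x ξ = evalAt v w U sgn ξ g * x ξ := by
  simp [op]

/-- The Weil representation of the line `V_s` over `U(V) = E_v^×/F_v^×`. -/
def ρ (s : ℤˣ) : Representation ℂ (Multiplicative (QuotA v w)) (Wsp v w U sgn s) where
  toFun := op v w U sgn s
  map_one' := by
    refine LinearMap.ext fun x => Finsupp.ext fun ξ => ?_
    simp [op_apply, evalAt_one]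
  map_mul' g h := by
    refine LinearMap.ext fun x => Finsupp.ext fun ξ => ?_
    simp [op_apply, evalAt_mul, mul_assoc]

/-- `ρ` acts by `op`. -/
theorem ρ_apply (s : ℤˣ) (g : Multiplicative (QuotA v w)) (x : Wsp v w U sgn s) (ξ : Good v w U sgn s) :
    ρ v w U sgn s g x ξ = evalAt v w U sgn ξ g * x ξ :=
  op_apply v w U sgn s g x ξ

/-- The carried Weil representations of the two lines. -/
def weilRep : WeilRep v w where
  Wsp := Wsp v w U sgn
  ωWeil := ρ v w U sgn

/-! ### The isotypic components -/

/-- The `α`-isotypic component of `ρ s` (with the additive structure of `QuotA v w` fixed first). -/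
abbrev isoQ (s : ℤˣ) (α : AddChar (QuotA v w) ℂ) : Submodule ℂ (Wsp v w U sgn s) :=
  @isotypic (QuotA v w) _ _ _ _ (ρ v w U sgn s) α

/-- The vectors fixed by an additive subgroup `H` of `QuotA v w`. -/
abbrev fixQ (s : ℤˣ) (H : AddSubgroup (QuotA v w)) : Submodule ℂ (Wsp v w U sgn s) :=
  @fixedBy (QuotA v w) _ _ _ _ (ρ v w U sgn s) H

/-- `e_ξ` lies in the `α`-isotypic component of `ρ s` when `α_K = ξ`. -/
theorem single_mem_isotypic (s : ℤˣ) (ξ : Good v w U sgn s) (α : AddChar (QuotA v w) ℂ)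
    (hα : ofOneQ v w α = ξ.1) :
    Finsupp.single ξ (1 : ℂ) ∈ isoQ v w U sgn s α := by
  show ∀ a : QuotA v w, ρ v w U sgn s (Multiplicative.ofAdd a) (Finsupp.single ξ 1) =
    α a • Finsupp.single ξ 1
  intro a
  classical
  obtain ⟨x, hx⟩ := QuotientGroup.mk_surjective (Additive.toMul a)
  have ha : Multiplicative.ofAdd a = toMulAdd v w x := by
    show Multiplicative.ofAdd a = Multiplicative.ofAdd (Additive.ofMul (x : (w.adicCompletion L)ˣ ⧸ Fsub v w))
    rw [hx, ofMul_toMul]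
  have hαx : α a = ((ξ.1 x : ℂˣ) : ℂ) := by
    rw [← hα, ofOneQ_apply, hx, ofMul_toMul]
  ext ζ
  rw [ρ_apply, Finsupp.smul_apply, ha, evalAt_toMulAdd, hαx, smul_eq_mul, Finsupp.single_apply]
  split_ifs with h
  · subst h
    rfl
  · simp

/-- A non-zero vector of the `α`-isotypic component forces `α_K ∈ Good s`. -/
theorem ofOneQ_mem_good_of_mem_isotypic {s : ℤˣ} {α : AddChar (QuotA v w) ℂ} {x : Wsp v w U sgn s}
    (hx : x ∈ isoQ v w U sgn s α) (hx0 : x ≠ 0) : ofOneQ v w α ∈ Good v w U sgn s := by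
  have hx' : ∀ a : QuotA v w, ρ v w U sgn s (Multiplicative.ofAdd a) x = α a • x := hx
  obtain ⟨ξ, hξ⟩ := Finsupp.support_nonempty_iff.mpr hx0
  have hξ0 : x ξ ≠ 0 := Finsupp.mem_support_iff.mp hξ
  have heq : ofOneQ v w α = ξ.1 := by
    refine MonoidHom.ext fun y => Units.ext ?_
    have h := congrArg (fun z : Wsp v w U sgn s => z ξ)
      (hx' (Additive.ofMul (y : (w.adicCompletion L)ˣ ⧸ Fsub v w)))
    simp only [ρ_apply, Finsupp.smul_apply, smul_eq_mul] at h
    have h' : evalAt v w U sgn ξ (Multiplicative.ofAdd (Additive.ofMul (y : (w.adicCompletion L)ˣ ⧸ Fsub v w)))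
        = ((ξ.1 y : ℂˣ) : ℂ) := evalAt_toMulAdd v w U sgn ξ y
    rw [h'] at h
    rw [ofOneQ_apply]
    exact (mul_right_cancel₀ hξ0 h).symm
  rw [heq]
  exact ξ.2

/-- THE ISOTYPIC CHARACTERISATION: the `α`-isotypic component of `ρ s` is non-zero iff `α_K ∈ Good s`. -/
theorem isotypic_ne_bot_iff (s : ℤˣ) (α : AddChar (QuotA v w) ℂ) :
    isoQ v w U sgn s α ≠ ⊥ ↔ ofOneQ v w α ∈ Good v w U sgn s := by
  constructor
  · intro hne
    obtain ⟨x, hx, hx0⟩ := (Submodule.ne_bot_iff _).mp hne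
    exact ofOneQ_mem_good_of_mem_isotypic v w U sgn hx hx0
  · intro h
    rw [Submodule.ne_bot_iff]
    exact ⟨Finsupp.single ⟨_, h⟩ 1, single_mem_isotypic v w U sgn s ⟨_, h⟩ α rfl,
      Finsupp.single_ne_zero.mpr one_ne_zero⟩

/-! ### Smoothness -/

/-- The kernel of a character of the quotient, pulled back to `E_v^×`, is the kernel of the character. -/
theorem comap_ker_liftG {s : ℤˣ} (ξ : Good v w U sgn s) :
    (liftG v w U sgn ξ).ker.comap (QuotientGroup.mk' (Fsub v w)) = ξ.1.ker := by
  ext x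
  simp only [Subgroup.mem_comap, MonoidHom.mem_ker, QuotientGroup.mk'_apply, liftG_mk]

/-- The kernel of a character of `Good s` has finite index in `E_v^×` (it contains `F_v^× U_E^n`). -/
theorem finiteIndex_ker (hUfin : ∀ n, (Fsub v w ⊔ U n).FiniteIndex) {s : ℤˣ} (ξ : Good v w U sgn s) :
    ξ.1.ker.FiniteIndex := by
  obtain ⟨n, hn⟩ := ξ.2.2.1
  haveI := hUfin n
  exact Subgroup.finiteIndex_of_le (sup_le (Fsub_le_ker v w ξ.2.1) hn)

/-- The kernel of the lifted character, as an additive subgroup of `QuotA v w`, has finite index. -/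
theorem kerA_finiteIndex (hUfin : ∀ n, (Fsub v w ⊔ U n).FiniteIndex) {s : ℤˣ} (ξ : Good v w U sgn s) :
    (Subgroup.toAddSubgroup (liftG v w U sgn ξ).ker).FiniteIndex := by
  refine AddSubgroup.finiteIndex_iff.mpr ?_
  rw [Subgroup.index_toAddSubgroup]
  have h := (liftG v w U sgn ξ).ker.index_comap_of_surjective (QuotientGroup.mk'_surjective (Fsub v w))
  rw [comap_ker_liftG] at h
  rw [← h]
  exact Subgroup.finiteIndex_iff.mp (finiteIndex_ker v w U sgn hUfin ξ)

/-- The stabiliser of a vector: the intersection of the kernels of the (lifted) characters in its support. -/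
def stab (s : ℤˣ) (x : Wsp v w U sgn s) : AddSubgroup (QuotA v w) :=
  ⨅ ξ : x.support, Subgroup.toAddSubgroup (liftG v w U sgn ξ.1).ker

/-- The stabiliser has finite index. -/
theorem stab_finiteIndex (hUfin : ∀ n, (Fsub v w ⊔ U n).FiniteIndex) (s : ℤˣ) (x : Wsp v w U sgn s) :
    (stab v w U sgn s x).FiniteIndex :=
  AddSubgroup.finiteIndex_iInf fun ξ => kerA_finiteIndex v w U sgn hUfin ξ.1

/-- The vector is fixed by its stabiliser. -/
theorem mem_fixedBy_stab (s : ℤˣ) (x : Wsp v w U sgn s) : x ∈ fixQ v w U sgn s (stab v w U sgn s x) := by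
  show ∀ k ∈ stab v w U sgn s x, ρ v w U sgn s (Multiplicative.ofAdd k) x = x
  intro k hk
  ext ξ
  rw [ρ_apply]
  by_cases hξ : ξ ∈ x.support
  · have hker : Additive.toMul k ∈ (liftG v w U sgn ξ).ker := AddSubgroup.mem_iInf.mp hk ⟨ξ, hξ⟩
    rw [MonoidHom.mem_ker] at hker
    simp only [evalAt, toAdd_ofAdd, hker, Units.val_one, one_mul]
  · rw [Finsupp.notMem_support_iff.mp hξ, mul_zero]

/-- Finite-index smoothness: every vector is fixed by a subgroup of finite index. -/
theorem isSmoothCompact (hUfin : ∀ n, (Fsub v w ⊔ U n).FiniteIndex) (s : ℤˣ) (x : Wsp v w U sgn s) :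
    ∃ H : AddSubgroup (QuotA v w), Nonempty (Fintype (QuotA v w ⧸ H)) ∧ x ∈ fixQ v w U sgn s H := by
  haveI := stab_finiteIndex v w U sgn hUfin s x
  haveI : Finite (QuotA v w ⧸ stab v w U sgn s x) := AddSubgroup.finite_quotient_of_finiteIndex
  exact ⟨stab v w U sgn s x, ⟨Fintype.ofFinite _⟩, mem_fixedBy_stab v w U sgn s x⟩

/-- The level of a character of `Good s`: some `n` with `U n ≤ ker ξ`. -/
def level {s : ℤˣ} (ξ : Good v w U sgn s) : ℕ := Classical.choose ξ.2.2.1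

/-- The defining property of the level. -/
theorem level_spec {s : ℤˣ} (ξ : Good v w U sgn s) : U (level v w U sgn ξ) ≤ ξ.1.ker :=
  Classical.choose_spec ξ.2.2.1

/-- Open smoothness: every vector is fixed by the image of some `U n` (the maximum of the levels of the
characters in its support), when the filtration is antitone. -/
theorem isSmoothOpen (hU : Antitone U) (s : ℤˣ) (x : Wsp v w U sgn s) :
    ∃ n : ℕ, ∀ u ∈ U n, ρ v w U sgn s (toMulAdd v w u) x = x := by
  classical
  refine ⟨x.support.sup (fun ξ => level v w U sgn ξ), fun u hu => ?_⟩
  ext ξ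
  rw [ρ_apply]
  by_cases hξ : ξ ∈ x.support
  · have hle : level v w U sgn ξ ≤ x.support.sup (fun ξ => level v w U sgn ξ) := Finset.le_sup hξ
    have hu' : u ∈ U (level v w U sgn ξ) := hU hle hu
    have h1 : ξ.1 u = 1 := MonoidHom.mem_ker.mp (level_spec v w U sgn ξ hu')
    rw [evalAt_toMulAdd, h1, Units.val_one, one_mul]
  · rw [Finsupp.notMem_support_iff.mp hξ, mul_zero]

/-- Both spaces are non-zero as soon as both signs occur on smooth conjugate-orthogonal characters. -/
theorem nontrivial_wsp (hboth : ∀ s : ℤˣ, ∃ ξ, ξ ∈ Good v w U sgn s) (s : ℤˣ) :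
    Nontrivial (Wsp v w U sgn s) := by
  obtain ⟨ξ, hξ⟩ := hboth s
  exact ⟨⟨Finsupp.single ⟨ξ, hξ⟩ 1, 0, Finsupp.single_ne_zero.mpr one_ne_zero⟩⟩

end

end Summit.Ventures.HodgeRepro2.T6.N5LocalQuotientToy
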